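import Literature.Topology.FourManifolds.HCobordismWallAssembly
import Literature.Topology.FourManifolds.MergingCobordism
import HarnessLib

/-!
# Wall's Theorem 2 reduced to Thm. 1, Lemma 2 and the realisation of automorphs on `∂V`

Topic `Literature/Topology/FourManifolds`; in the cone of the named fact
`Literature.Topology.FourManifolds.isHCobordant_of_equivalent_intersectionForm` (**Wall 1964,
Thm. 2**: closed smooth simply connected 4-manifolds with isometric intersection forms are
h-cobordant; C. T. C. Wall, *On simply-connected 4-manifolds*, J. London Math. Soc. 39 (1964)
141–149; `HCobordismDonaldson.lean`).

`HCobordismWallAssembly.lean` proves Thm. 2 along §2 of the paper from FOUR inputs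
(`isHCobordant_of_equivalent_intersectionForm_of_constructions hT1 hL2 hreal hmerge`);
`MergingCobordism.lean` constructs the neck-filling cobordism `W₀ = (M₁ × I) ♮ (M₂ × I)` with its
second homology and so DISCHARGES `hmerge` (`MergingCobordism.hmerge_holds`). This file records
the resulting three-input form: Thm. 2 GIVEN Wall's Thm. 1 (`hT1`: a closed smooth simply
connected 4-manifold of signature `0` bounds a compact simply connected `W⁵` with `Hₖ(W) = 0`,
`k ≥ 3`, and `H₂(W)` finitely generated free — Thom's `Ω₄ ≅ ℤ`, Lemma 1 and Milnor's surgery,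
pp. 142–143), Wall's Lemma 2 (`hL2`, the tree's named fact
`exists_handlebody_isHCobordant_boundary`, pp. 143–144) and the realisation of every automorph of
the intersection form of `∂V`, `V ∈ ℋ(5, k, 2)`, by a diffeomorphism (`hreal`: Wall's refs. [10]
*Classification problems … (I)*, Topology 2 (1963), and [11] *Diffeomorphisms of 4-manifolds*,
ibid. 131–140, Cor. to Thm. 2; p. 145 "by the result quoted above").

Also recorded: `isHCobordant_of_thm1_lemma2_realisation_of_finrank_ne_one`, Thm. 2 for
`rank H²(M₁; ℤ)/T ≠ 1` from Thm. 1 for rank `≠ 2` (the af-cyclic first stage of Wall's order of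
proof: Thm. 1 for rank `2` is obtained on p. 146 through Thm. 2 for rank `≠ 1`).

Everything is proved; no named fact and no definition is introduced.

## References

* C. T. C. Wall, *On simply-connected 4-manifolds*, J. London Math. Soc. 39 (1964) 141–149,
  Thm. 2 and §2 pp. 144–146. [WallJLMS1964]
* M. A. Kervaire, J. W. Milnor, *Groups of homotopy spheres: I*, Ann. of Math. (2) 77 (1963), §2
  Lemma 2.2. [KervaireMilnorAnnals1963]
-/

open scoped Manifold ContDiff Topology
open Set Function CategoryTheory CategoryTheory.Limits
open Literature.AlgebraicTopology.SingularHomology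

noncomputable section

namespace Literature.Topology.FourManifolds

/-- Local notation: `𝔼 n` is the model Euclidean space `EuclideanSpace ℝ (Fin n)`. -/
local notation "𝔼 " n:arg => EuclideanSpace ℝ (Fin n)

section Wall

/-- Local notation: `Q⟦μ⟧` is the intersection form on `H²(M; ℤ)/T` of the closed `ℤ`-oriented
topological 4-manifold `(M, μ)` (as in `HCobordismDonaldson.lean`). -/
local notation "Q⟦" μ "⟧" =>
  Literature.AlgebraicTopology.SingularHomology.intersectionForm two_add_two_eq_four μ

/-- **Wall's Theorem 2 (1964) from Thm. 1, Lemma 2 and the realisation of automorphs on `∂V`**: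
the four-input assembly `isHCobordant_of_equivalent_intersectionForm_of_constructions`
(`HCobordismWallAssembly.lean`) with its merging-cobordism input `hmerge` DISCHARGED by
`MergingCobordism.hmerge_holds`. GIVEN (`hT1`) Wall's Thm. 1 — a closed smooth simply connected
4-manifold of signature `0` bounds a compact simply connected `W⁵` with `Hₖ(W) = 0` (`k ≥ 3`)
and `H₂(W)` finitely generated free —, (`hL2`) Wall's Lemma 2
(`exists_handlebody_isHCobordant_boundary`) and (`hreal`) the realisation of every automorph of
the intersection form of `∂V`, `V ∈ ℋ(5, k, 2)`, by a diffeomorphism (Wall's refs. [10], [11]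
Cor. to Thm. 2), **closed smooth simply connected 4-manifolds with isometric intersection forms
are h-cobordant**. [cite: WallJLMS1964, Thm. 2 and §2 pp. 144–146] -/
theorem isHCobordant_of_equivalent_intersectionForm_of_thm1_lemma2_realisation
    (hT1 : ∀ (N : Type) [TopologicalSpace N] [T2Space N] [SecondCountableTopology N]
      [ChartedSpace (𝔼 4) N] [CompactSpace N] [IsManifold (𝓡 4) ∞ N] [SimplyConnectedSpace N]
      (π : HomologicalOrientation ℤ N 4), π.signature = 0 →
      ∃ c : NullCobordism.{0} 4 N, SimplyConnectedSpace c.W ∧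
        (∀ k : ℕ, 3 ≤ k → IsZero (singularHomology ℤ ℤ c.W k)) ∧
        Module.Free ℤ (singularHomology ℤ ℤ c.W 2) ∧ Module.Finite ℤ (singularHomology ℤ ℤ c.W 2))
    (hL2 : exists_handlebody_isHCobordant_boundary)
    (hreal : ∀ (V : Type) [TopologicalSpace V] [T2Space V] [SecondCountableTopology V]
      [ChartedSpace (EuclideanHalfSpace (4 + 1)) V] [IsManifold (𝓡∂ (4 + 1)) ∞ V] [CompactSpace V]
      (k : ℕ), HasHandleDecomposition 4 V (twoHandlebodyCount k) →
      ∀ (β : HomologicalOrientation ℤ ((𝓡∂ (4 + 1)).boundary V) 4)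
        (A : (Q⟦β⟧).IsometryEquiv (Q⟦β⟧)), IsRealisedByDiffeomorph β A) :
    isHCobordant_of_equivalent_intersectionForm :=
  isHCobordant_of_equivalent_intersectionForm_of_constructions hT1 hL2 hreal MergingCobordism.hmerge_holds

/-- **Wall's Theorem 2 for `rank H²(M₁; ℤ)/T ≠ 1` from Thm. 1 for rank `≠ 2`, Lemma 2 and the
realisation of automorphs on `∂V`** — the af-cyclic first stage of Wall's order of proof (p. 143:
Thm. 1 is proved directly for rank `≥ 4`, rank `0` being ref. [9]; p. 146: rank `2` only through
Thm. 2 for rank `≠ 1`), with the merging cobordism discharged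
(`isHCobordant_of_constructions_of_finrank_ne_one` fed with `MergingCobordism.hmerge_holds`).
[cite: WallJLMS1964, §2 p. 146; Thm. 1 p. 142 and p. 143] -/
theorem isHCobordant_of_thm1_lemma2_realisation_of_finrank_ne_one
    (hT1r : ∀ (N : Type) [TopologicalSpace N] [T2Space N] [SecondCountableTopology N]
      [ChartedSpace (𝔼 4) N] [CompactSpace N] [IsManifold (𝓡 4) ∞ N] [SimplyConnectedSpace N]
      (π : HomologicalOrientation ℤ N 4), π.signature = 0 →
      Module.finrank ℤ ↥(freeCohomology ℤ N 2) ≠ 2 →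
      ∃ c : NullCobordism.{0} 4 N, SimplyConnectedSpace c.W ∧
        (∀ k : ℕ, 3 ≤ k → IsZero (singularHomology ℤ ℤ c.W k)) ∧
        Module.Free ℤ (singularHomology ℤ ℤ c.W 2) ∧ Module.Finite ℤ (singularHomology ℤ ℤ c.W 2))
    (hL2 : exists_handlebody_isHCobordant_boundary)
    (hreal : ∀ (V : Type) [TopologicalSpace V] [T2Space V] [SecondCountableTopology V]
      [ChartedSpace (EuclideanHalfSpace (4 + 1)) V] [IsManifold (𝓡∂ (4 + 1)) ∞ V] [CompactSpace V]
      (k : ℕ), HasHandleDecomposition 4 V (twoHandlebodyCount k) →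
      ∀ (β : HomologicalOrientation ℤ ((𝓡∂ (4 + 1)).boundary V) 4)
        (A : (Q⟦β⟧).IsometryEquiv (Q⟦β⟧)), IsRealisedByDiffeomorph β A)
    (M₁ M₂ : Type) [TopologicalSpace M₁] [T2Space M₁] [SecondCountableTopology M₁]
    [ChartedSpace (𝔼 4) M₁] [CompactSpace M₁] [IsManifold (𝓡 4) ∞ M₁] [SimplyConnectedSpace M₁]
    [TopologicalSpace M₂] [T2Space M₂] [SecondCountableTopology M₂]
    [ChartedSpace (𝔼 4) M₂] [CompactSpace M₂] [IsManifold (𝓡 4) ∞ M₂] [SimplyConnectedSpace M₂]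
    (μ : HomologicalOrientation ℤ M₁ 4) (ν : HomologicalOrientation ℤ M₂ 4)
    (hr : Module.finrank ℤ ↥(freeCohomology ℤ M₁ 2) ≠ 1) (h : (Q⟦μ⟧).Equivalent (Q⟦ν⟧)) :
    IsHCobordant 4 M₁ M₂ :=
  isHCobordant_of_constructions_of_finrank_ne_one hT1r hL2 hreal MergingCobordism.hmerge_holds
    M₁ M₂ μ ν hr h

end Wall

end Literature.Topology.FourManifolds

end
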